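import Summits.AtomisticToContinuum.Crystallization.Theorems.FrustratedLawDichotomyAtlasReach
import Summits.AtomisticToContinuum.Crystallization.Theorems.FrustratedLawDichotomyRangeCut
import Summits.AtomisticToContinuum.Crystallization.Theorems.FrustratedLawDichotomyDoublingGap
import Summits.AtomisticToContinuum.Crystallization.Theorems.FrustratedLawDichotomyTextureAllBad
/-!
# Frustrated-law dichotomy — the ISOHEDRAL CUT of the aperiodic law gap (decomposition cell `decomp-a2c`, lens 5, g122)

Target: the crux `…Theses.FrustratedLawDichotomy.AperiodicFrustratedLawGap` (stmt-27623) in the contrapositive form of (404)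
`…AtlasReach.NoAdmissibleMinimiserWith` («no admissible minimising law in the regime `X`»), and the residual of record
A(η) = `…AtlasReach.OffAtlasMassGap n K η`.

LENS 5 («finite/low-complexity range certified by computation + asymptotic regime + bridge»), applied to the dial
**LOCAL COMPLEXITY = number of congruence classes of bounded environments**, not to mass (the cap/reach lane, blocked by (411)/(434)/(473))
and not to contact tolerance (lens 1's band ladder).  The only value of the dial at which the range collapses is ONE class: a hard-core
configuration all of whose `ρ`-environments are pairwise `ε`-congruent (an `(ε,ρ)`-ISOHEDRAL configuration, «the sliver») is, for `ρ` past the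
regularity radius and `ε → 0`, locally indistinguishable from a REGULAR SYSTEM — one orbit of a crystallographic group (local criterion for
regular systems, Delone–Dolbilin–Shtogrin–Galiulin 1976; Dolbilin–Lagarias–Senechal 1998) — and on one-orbit configurations the root energy IS the
energy per particle, a certified lattice sum.  Hence the AND-node (every junction below is kernel-checked):

  crux ⟸ F ∧ E,   F := `IsohedralSliverGap` ⟸ T ∧ UP(eUp) ∧ (eUp < t) ∧ C(t) ∧ D,   A(η) ⟸ F ∧ E_A(η),

* T  `TextureForcesBadAtoms`  [TREE — PROVED here as `textureForcesBadAtoms` from hand-1's `…TextureAllBad.not_robustGood_of_texture`]: the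
     texture binder (d) of the crux forces every atom of the rooted configuration to be `1/20`-BAD in the atom-level, boundary-gapped sense `GoodAtom`.
* UP `…RangeCut.PeriodicEnergyCeiling eUp` [TREE — `…PeriodicEnergyCeilingKernel.periodicEnergyCeiling_holds`, `eUp = −0.7175`].
* C  `OneOrbitFloor t`        [WEAKER · INSTRUMENTABLE · UNDECIDED(test)] — THE FINITE RANGE: every rooted `7/10`-hard-core ONE-ORBIT configuration with
     covering radius `≤ 2` whose root is `1/20`-bad has root energy `≥ t`.  One-orbit Delone sets of `ℝ³` are the crystallographic point orbits
     (Schoenflies–Bieberbach), a compact explicit family; the claim `∃ t > −0.7175` is a certified Lennard-Jones lattice-sum sweep over the bad part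
     of that family against UP.  Test = that sweep (desk lattice sums, tail-corrected, cutoff 6.5: excess over `e_fcc` AT the `1/20` distortion
     threshold = fcc simple shear +0.0055, fcc uniaxial +0.0062, Bain path +0.0082, hcp `c/a` +0.011; bcc +0.031; expected `t − eUp ≈ 5·10⁻³`).
* D  `RobustIsohedralFloor`   [WEAKER · ATTACKABLE (L)] — THE ASYMPTOTIC REGIME `ε → 0`: a one-orbit floor `t` transfers, with any loss `t' < t`, to
     all-bad `(ε,ρ)`-isohedral covered configurations for SOME `ρ, ε > 0` (ineffective: compactness of hard-core rooted configurations in the local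
     topology + the local criterion for regular systems in the limit + continuity of `rootEnergy` under `r⁻⁶` tails).  Pure geometry/analysis.
* E  `DiverseLawGap`          [DECLARED RESIDUAL · UNDECIDED → IDEA-NEEDED · BARRIER LocalCertificate] — no admissible minimiser among laws that are NOT
     a.s. in the sliver.  Crux ⟹ E (kernel); E ⟹ crux only together with F: the residual is the crux minus a sliver, honestly ≈ the crux.
* E_A `DiverseOffAtlasMassGap n K η` — the same cut made RELATIVE to the residual of record A(η) (kernel both ways round).

WHY EACH PIECE IS STRICTLY WEAKER.  C, D mention no law, no stationarity, no minimisation: C is a statement about finitely-parametrised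
periodic/finite point orbits, D a continuity statement; the crux implies neither formally and each is of independent (small) standing; T and UP are
theorems.  E and E_A are the crux / A(η) restricted to a co-sliver (kernel `diverseLawGap_of_aperiodicFrustratedLawGap`,
`diverseOffAtlasMassGap_of_offAtlasMassGap`).
WHY NOVEL (by construction, against lenses 1–4/6 and the hands).  First node whose split variable is LOCAL COMPLEXITY and whose finite range is
certified by LATTICE SUMS OVER CRYSTALLOGRAPHIC ORBITS reached through the GEOMETRIC local criterion for regular systems (a theorem), not through
contact-tolerance rigidity (lens 1: Flyspeck L12 / quasi-twelve compactness), grain/core surgery doors (lens 2), charted planar order (lens 3), the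
ENERGETIC local rule «isobinding ⇒ regular» (lens 4 g5, conjectural), or mass caps (this lineage, (404)–(473)).
THE LADDER (§5): rung `L` = laws with `≤ L` congruence classes of `ρ`-environments (`SliverL L`); finite range C_L = certified `≤ L`-orbit
lattice sums at LAW level (the root energy of a multi-orbit crystal is an orbit's site energy; point-stationarity equidistributes the root —
Palm bookkeeping inside the instrument); asymptotic regime D_L = the local criterion for MULTIREGULAR systems (Dolbilin–Lagarias–Senechal 1998)
through tightness; residual E_L weakens rung by rung (`complexLawGap_mono`, kernel).
HOW FAR THE FINITE RANGE MUST REACH FOR THE BRIDGE TO BITE (lens-5 duty): NO finite `L` — each rung removes only the `(ε_L,ρ_L)`-near-crystalline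
laws with `≤ L` orbits; `⋂_L` co-ranges = admissible minimisers of UNBOUNDED local complexity (the genuinely aperiodic enemy), and rung `L ≥ 2`
already costs a certified sweep over all `≤ L`-orbit space-group structures.  Recorded with the mass dial ((411)/(434): reach < 1/109) and the
tolerance dial (two-shell rigidity ≤ 0.67 %, stmt-4146, vs energetic visibility ≳ 3 %) as the lineage's three-dial census (memo NODE-g122.md).

House rules: every piece is a `def : Prop` consumed as a hypothesis; no new axioms; only the three standard axioms appear in the junctions.
-/

noncomputable section

namespace Summit.AtomisticToContinuum.Crystallization.Theorems.FrustratedLawDichotomyIsohedralCut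

open MeasureTheory Set Filter
open scoped ENNReal BigOperators
open Literature.MathematicalPhysics.StatisticalMechanics Literature.Probability.Process
open Literature.Geometry.DiscreteGeometry (fccKissingPattern hcpKissingPattern)
open Summit.AtomisticToContinuum.Crystallization.Theorems.ChargedEnergyGapNegative (E3 eStar)
open Summit.AtomisticToContinuum.Crystallization.Theorems.FrustratedLawDichotomyAtlasReach
  (NoAdmissibleMinimiserWith OffAtlasMassGap noAdmissibleMinimiserWith_mono noAdmissibleMinimiserWith_split
    aperiodicFrustratedLawGap_of_noAdmissibleMinimiser noAdmissibleMinimiser_of_aperiodicFrustratedLawGap)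
open Summit.AtomisticToContinuum.Crystallization.Theorems.FrustratedLawDichotomyRangeCut (PeriodicEnergyCeiling eStar_le_of_periodicEnergyCeiling)
open Summit.AtomisticToContinuum.Crystallization.Theorems.FrustratedLawDichotomyFiniteClusterGap (integrable_rootEnergy_of_ae_hardCore)
open Summit.AtomisticToContinuum.Crystallization.Theorems.FrustratedLawDichotomyTextureAllBad (not_robustGood_of_texture)

/-! ## §1. Atom-level objects: gapped goodness, environment congruence, the sliver, one-orbit configurations -/

/-- **Gapped kissing-pattern fit of the atom `q` of `μ` to the pattern `S`** (the atom-level copy of (436) `…RangeCut.GoodAt`, an OPEN condition):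
some isometric copy of `S` at a scale `d` realised by the nearest atom fits twelve atoms within `η·d`, `η < ηmax`, and the shell below `13/10·d`
is clean with a two-sided gap `γ` (so the fit survives small perturbations — the point of the gap). -/
def GoodAtomWith (S : Finset E3) (ηmax : ℝ) (μ : Measure E3) (q : E3) : Prop :=
  ∃ (d η γ : ℝ) (A : E3 →ₗᵢ[ℝ] E3) (t : ↥S → E3), 0 < d ∧ 0 < γ ∧ η < ηmax ∧
    (∀ u : ↥S, μ {t u} ≠ 0 ∧ ‖(t u - q) - d • A (u : E3)‖ ≤ η * d) ∧
    (∀ s : E3, μ {s} ≠ 0 → s ≠ q → d ≤ dist s q) ∧ (∃ s : E3, μ {s} ≠ 0 ∧ s ≠ q ∧ dist s q ≤ d) ∧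
    (∀ s : E3, μ {s} ≠ 0 → s ≠ q → dist s q < 13 / 10 * d + γ → dist s q ≤ 13 / 10 * d - γ ∧ s ∈ Set.range t)

/-- **`GoodAtom ηmax μ q`**: the atom `q` of `μ` is fcc- OR hcp-kissing-pattern good at tolerance `< ηmax` (gapped). -/
def GoodAtom (ηmax : ℝ) (μ : Measure E3) (q : E3) : Prop :=
  GoodAtomWith fccKissingPattern ηmax μ q ∨ GoodAtomWith hcpKissingPattern ηmax μ q

/-- Loosening the tolerance keeps a good atom good. [new: bookkeeping] -/
theorem goodAtomWith_mono {S : Finset E3} {η₀ η₁ : ℝ} (h : η₀ ≤ η₁) {μ : Measure E3} {q : E3} (hq : GoodAtomWith S η₀ μ q) :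
    GoodAtomWith S η₁ μ q := by
  obtain ⟨d, η, γ, A, t, hd, hγ, hη, hrest⟩ := hq
  exact ⟨d, η, γ, A, t, hd, hγ, hη.trans_le h, hrest⟩

/-- `GoodAtom` is monotone in the tolerance. [new: bookkeeping] -/
theorem goodAtom_mono {η₀ η₁ : ℝ} (h : η₀ ≤ η₁) {μ : Measure E3} {q : E3} (hq : GoodAtom η₀ μ q) : GoodAtom η₁ μ q :=
  hq.imp (goodAtomWith_mono h) (goodAtomWith_mono h)

/-- **`(ε,ρ)`-congruence of the environments of the atoms `p` and `q`**: an isometry of space carrying `p` to `q` matches the atoms within `ρ` of `p`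
to atoms within `ε`, and every atom within `ρ` of `q` is within `ε` of the image of an atom (a two-sided Hausdorff matching after alignment). -/
def EnvCongr (ε ρ : ℝ) (μ : Measure E3) (p q : E3) : Prop :=
  ∃ g : E3 ≃ᵢ E3, g p = q ∧
    (∀ z : E3, μ {z} ≠ 0 → dist z p ≤ ρ → ∃ z' : E3, μ {z'} ≠ 0 ∧ dist (g z) z' ≤ ε) ∧
    (∀ z' : E3, μ {z'} ≠ 0 → dist z' q ≤ ρ → ∃ z : E3, μ {z} ≠ 0 ∧ dist (g z) z' ≤ ε)

/-- **Covering radius at most `2`**: every point of space is within `2` of an atom (relative density; holds for every near-close-packed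
configuration, covering radius `≈ 0.71·d`). -/
def Covered (μ : Measure E3) : Prop :=
  ∀ x : E3, ∃ z : E3, μ {z} ≠ 0 ∧ dist x z ≤ 2

/-- ★ **THE SLIVER `(ε,ρ)`**: a covered configuration ALL of whose atoms have pairwise `(ε,ρ)`-congruent environments — local complexity ONE at
scale `ρ` and tolerance `ε` (the `L = 1` value of the complexity dial). -/
def Sliver (ε ρ : ℝ) (μ : Measure E3) : Prop :=
  Covered μ ∧ ∀ p q : E3, μ {p} ≠ 0 → μ {q} ≠ 0 → EnvCongr ε ρ μ p q

/-- **One-orbit (isogonal) configuration**: the isometries of space preserving the atom weights act transitively on the atoms.  The covered ones are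
exactly the crystallographic point orbits of `ℝ³` (Schoenflies–Bieberbach); uncovered ones include finite isogonal sets and rods/slabs. -/
def OneOrbit (μ : Measure E3) : Prop :=
  ∀ p q : E3, μ {p} ≠ 0 → μ {q} ≠ 0 → ∃ g : E3 ≃ᵢ E3, g p = q ∧ ∀ z : E3, μ {g z} = μ {z}

/-- A one-orbit configuration lies in every sliver it is covered for (`ε ≥ 0`, any `ρ`): the finite range sits inside the sliver. [new: bookkeeping] -/
theorem sliver_of_oneOrbit {ε ρ : ℝ} (hε : 0 ≤ ε) {μ : Measure E3} (h1 : OneOrbit μ) (hc : Covered μ) : Sliver ε ρ μ := by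
  refine ⟨hc, fun p q hp hq => ?_⟩
  obtain ⟨g, hgp, hg⟩ := h1 p q hp hq
  refine ⟨g, hgp, fun z hz _ => ⟨g z, by rwa [hg z], by simpa using hε⟩, fun z' hz' _ => ⟨g.symm z', ?_, by simpa using hε⟩⟩
  have := hg (g.symm z')
  rw [IsometryEquiv.apply_symm_apply] at this
  rwa [← this]

/-! ## §2. The pieces -/

/-- T «TEXTURE FORCES BAD ATOMS» [TREE — proved below]: for a rooted `7/10`-hard-core configuration, the texture binder (d) of the crux — the
`Gy/TexBall/Appr` let-chain VERBATIM from (404) `NoAdmissibleMinimiserWith` — forbids every atom to be `GoodAtom (1/20)`: a gapped fit at an atom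
would be seen, at window precision `ε ≪ γ·d`, as a `Gy (1/20)`-good window site, against clause (b) of `TexBall`. [new: junction] -/
def TextureForcesBadAtoms : Prop :=
  let Gy : ℝ → (N : ℕ) → (Fin N → EuclideanSpace ℝ (Fin 3)) → Fin N → Prop := fun η N y j => let d : ℝ := sInf ((fun z => dist z (y (j : Fin N))) '' (Set.range (y) \ {(y (j : Fin N))})); let T : Set (EuclideanSpace ℝ (Fin 3)) := {z : EuclideanSpace ℝ (Fin 3) | z ∈ Set.range (y) ∧ z ≠ (y (j : Fin N)) ∧ dist z (y (j : Fin N)) < 13 / 10 * d}; ∃ A : EuclideanSpace ℝ (Fin 3) →ₗᵢ[ℝ] EuclideanSpace ℝ (Fin 3), (∃ e : ↥T ≃ ↥Literature.Geometry.DiscreteGeometry.fccKissingPattern, ∀ t : ↥T, dist (d⁻¹ • ((t : EuclideanSpace ℝ (Fin 3)) - (y (j : Fin N)))) (A ((e t : ↥Literature.Geometry.DiscreteGeometry.fccKissingPattern) : EuclideanSpace ℝ (Fin 3))) ≤ η) ∨ (∃ e : ↥T ≃ ↥Literature.Geometry.DiscreteGeometry.hcpKissingPattern, ∀ t : ↥T,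 dist (d⁻¹ • ((t : EuclideanSpace ℝ (Fin 3)) - (y (j : Fin N)))) (A ((e t : ↥Literature.Geometry.DiscreteGeometry.hcpKissingPattern) : EuclideanSpace ℝ (Fin 3))) ≤ η); let TexBall : (N : ℕ) → (Fin N → EuclideanSpace ℝ (Fin 3)) → Fin N → ℝ → ℝ → ℝ → ℝ → Prop := fun N y i R R₇ R₈ R₉ => (∀ a b : Fin N, a ≠ b → (7 : ℝ) / 10 ≤ dist (y a) (y b)) ∧ (∀ j : Fin N, dist (y j) (y i) ≤ R → ¬ Gy (1 / 20) N (y) j) ∧ (∀ j : Fin N, dist (y j) (y i) ≤ R → ¬ ((∀ j' : Fin N, dist (y j') (y j) ≤ R₇ → ¬ Gy (1 / 20) N (y) j') ∧ (∀ z : EuclideanSpace ℝ (Fin 3), dist z (y j) ≤ R₇ → ∃ k : Fin N, dist z (y k) ≤ 1) ∧ (∀ j' : Fin N, dist (y j') (y j) ≤ R₇ → (let d : ℝ := sInf ((fun z => dist z (y j')) '' (Set.range (y) \ {(y j')})); ∀ k : Fin N, y k ≠ y j' → dist (y k) (y j') < 27 / 20 * d → 5 ≤ Nat.card {m : Fin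 N // y m ≠ y j' ∧ dist (y m) (y j') < 27 / 20 * d ∧ y m ≠ y k ∧ dist (y m) (y k) < 27 / 20 * d})))) ∧ (∀ j : Fin N, dist (y j) (y i) ≤ R → ∃ k : Fin N, dist (y k) (y j) ≤ R₈ ∧ Gy (1 / 8) N (y) k) ∧ (∀ j : Fin N, dist (y j) (y i) ≤ R → ¬ ((∀ j' : Fin N, dist (y j') (y j) ≤ R₉ → ¬ Gy (1 / 20) N (y) j') ∧ (Nat.card {j' : Fin N // dist (y j') (y j) ≤ R₉ ∧ ¬ Gy (1 / 8) N (y) j'} : ℝ) ≤ 1 / 2 * (Nat.card {j' : Fin N // dist (y j') (y j) ≤ R₉} : ℝ) ∧ (∀ j' : Fin N, dist (y j') (y j) ≤ R₉ → ¬ Gy (1 / 8) N (y) j' → ¬ (let d : ℝ := sInf ((fun z => dist z (y j')) '' (Set.range (y) \ {(y j')})); ∀ k : Fin N, y k ≠ y j' → dist (y k) (y j') < 27 / 20 * d → 5 ≤ Nat.card {m : Fin N // y m ≠ y j' ∧ dist (y m) (y j') < 27 / 20 * d ∧ y m ≠ y k ∧ dist (y m) (y k) < 27 / 20 * d}))));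 let Appr : MeasureTheory.Measure (EuclideanSpace ℝ (Fin 3)) → ℝ → ℝ → ℝ → Prop := fun μ R₇ R₈ R₉ => ∀ q : EuclideanSpace ℝ (Fin 3), μ {q} ≠ 0 → ∀ R ε : ℝ, 0 < ε → ∃ (N : ℕ) (y : Fin N → EuclideanSpace ℝ (Fin 3)) (i : Fin N), TexBall N y i R R₇ R₈ R₉ ∧ (∀ p : EuclideanSpace ℝ (Fin 3), μ {p} ≠ 0 → dist p q ≤ R → ∃ k : Fin N, dist (y k - y i) (p - q) ≤ ε) ∧ (∀ k : Fin N, dist (y k) (y i) ≤ R → ∃ p : EuclideanSpace ℝ (Fin 3), μ {p} ≠ 0 ∧ dist (y k - y i) (p - q) ≤ ε);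
  ∀ (μ : MeasureTheory.Measure (EuclideanSpace ℝ (Fin 3))) (R₇ R₈ R₉ : ℝ), Literature.Probability.Process.IsRootedHardCore (7 / 10) μ → Appr μ R₇ R₈ R₉ →
    ∀ q : EuclideanSpace ℝ (Fin 3), μ {q} ≠ 0 → ¬ GoodAtom (1 / 20) μ q

/-- ★ **T is a theorem**: hand-1's `…TextureAllBad.not_robustGood_of_texture` (tree) refutes gapped `1/20`-goodness at every atom of a texture-charged
rooted hard-core configuration, for the fcc and the hcp pattern; `GoodAtom` is literally the `∃`-form of the conjunction refuted there. [tree: cite] -/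
theorem textureForcesBadAtoms : TextureForcesBadAtoms := by
  dsimp only [TextureForcesBadAtoms]
  intro μ R₇ R₈ R₉ hμ hAp q hq hgood
  have h := not_robustGood_of_texture (δ := 7 / 10) (by norm_num) hμ (fun q' hq' R ε hε => by
    obtain ⟨N, y, i, ⟨hsep, h2, -, -, -⟩, hm1, hm2⟩ := hAp q' hq' R ε hε
    exact ⟨N, y, i, hsep, h2, hm1, hm2⟩) hq
  rcases hgood with ⟨d, η, γ, A, t, hrest⟩ | ⟨d, η, γ, A, t, hrest⟩
  · exact (h d η γ A).1 t hrest
  · exact (h d η γ A).2 t hrest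

/-- C(t) ★ «ONE-ORBIT FLOOR» — THE FINITE RANGE [WEAKER · INSTRUMENTABLE · UNDECIDED(test: certified lattice-sum sweep)]: every rooted `7/10`-hard-core,
covered, ONE-ORBIT configuration whose root is not `GoodAtom (1/20)` has root energy `≥ t`.  By transitivity the root condition is the all-sites
condition; the covered one-orbit sets are the crystallographic point orbits (finitely many Wyckoff types × compact lattice/position parameters under
hard core `7/10` and covering `2`).  Wanted with some `t > −0.7175`. [new: junction] -/
def OneOrbitFloor (t : ℝ) : Prop :=
  ∀ μ : Measure E3, IsRootedHardCore (7 / 10) μ → Covered μ → OneOrbit μ → ¬ GoodAtom (1 / 20) μ 0 → t ≤ rootEnergy lennardJones μ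

/-- D ★ «ROBUST ISOHEDRAL FLOOR» — THE ASYMPTOTIC REGIME [WEAKER · ATTACKABLE (L)]: a one-orbit floor `t` transfers with any loss to all-bad sliver
configurations for SOME radius `ρ` and tolerance `ε` (ineffective).  Route: local compactness of rooted `7/10`-hard-core covered configurations; an
`ε → 0` limit of `(ε,ρ)`-isohedral configurations is exactly `ρ`-isohedral and Delone, hence one orbit once `ρ` exceeds the regularity radius
(local criterion for regular systems); `¬ GoodAtom (1/20)` is closed and `rootEnergy` continuous under uniform `r⁻⁶` tails. [new: junction] -/
def RobustIsohedralFloor : Prop :=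
  ∀ t t' : ℝ, t' < t → OneOrbitFloor t → ∃ ρ : ℝ, 0 < ρ ∧ ∃ ε : ℝ, 0 < ε ∧
    ∀ μ : Measure E3, IsRootedHardCore (7 / 10) μ → (∀ q : E3, μ {q} ≠ 0 → ¬ GoodAtom (1 / 20) μ q) → Sliver ε ρ μ → t' ≤ rootEnergy lennardJones μ

/-- F ★ «ISOHEDRAL SLIVER GAP» [WEAKER · PROVED below from T, UP, C, D]: for some `(ε,ρ)`, no admissible minimising law is almost surely in the sliver.
[new: junction] -/
def IsohedralSliverGap : Prop :=
  ∃ ρ : ℝ, 0 < ρ ∧ ∃ ε : ℝ, 0 < ε ∧ NoAdmissibleMinimiserWith fun P => ∀ᵐ μ ∂P, Sliver ε ρ μ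

/-- E ★ «DIVERSE LAW GAP» — THE DECLARED RESIDUAL [WEAKER than the crux by restriction · UNDECIDED → IDEA-NEEDED · BARRIER LocalCertificate]: for every
`(ε,ρ)`, no admissible minimising law fails to be almost surely in the sliver.  Equivalent to the crux once F holds; the co-sliver contains every
law anybody expects (Frank–Kasper, strained polytypes, generic aperiodic textures). [new: junction] -/
def DiverseLawGap : Prop :=
  ∀ ρ : ℝ, 0 < ρ → ∀ ε : ℝ, 0 < ε → NoAdmissibleMinimiserWith fun P => ¬ ∀ᵐ μ ∂P, Sliver ε ρ μ

/-- E_A(η) «DIVERSE OFF-ATLAS MASS GAP» — the cut made relative to the residual of record A(η) = `OffAtlasMassGap n K η`: no admissible minimising law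
is outside the sliver AND gives the uncovered set `(⋃_{i<n} K i)ᶜ` mass `≥ η`.  Weaker than both E and A(η). [new: junction] -/
def DiverseOffAtlasMassGap (n : ℕ) (K : ℕ → Set (Measure E3)) (η : ℝ) : Prop :=
  ∀ ρ : ℝ, 0 < ρ → ∀ ε : ℝ, 0 < ε →
    NoAdmissibleMinimiserWith fun P => (¬ ∀ᵐ μ ∂P, Sliver ε ρ μ) ∧ η ≤ P.real (⋃ i ∈ Finset.range n, K i)ᶜ

/-! ## §3. Junctions (kernel-checked) -/

/-- relative regime split: inside a regime `Y`, a sub-regime and its complement exhaust. [new: bookkeeping] -/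
theorem noAdmissibleMinimiserWith_relSplit (X Y : Measure (Measure E3) → Prop) (hX : NoAdmissibleMinimiserWith fun P => Y P ∧ X P)
    (hX' : NoAdmissibleMinimiserWith fun P => Y P ∧ ¬ X P) : NoAdmissibleMinimiserWith Y := by
  intro P
  have h1 := hX P
  have h2 := hX' P
  dsimp only at h1 h2 ⊢
  intro hP ha hb hd he h0 hmin hY
  by_cases hx : X P
  · exact h1 hP ha hb hd he h0 hmin ⟨hY, hx⟩
  · exact h2 hP ha hb hd he h0 hmin ⟨hY, hx⟩

/-- ★★ F PROVED FROM THE LENS-5 TRIPLE: texture transfer T (theorem), a ceiling `UP(eUp)`, a one-orbit floor `t > eUp` (finite range C) and the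
robust transfer D (asymptotic regime) give the sliver gap — an admissible minimising law a.s. in the sliver would have `E_P ≥ t' > eUp ≥ e⋆ ≥ E_P`.
[new: junction] -/
theorem isohedralSliverGap_of_pieces {eUp t : ℝ} (hU : PeriodicEnergyCeiling eUp) (ht : eUp < t)
    (hC : OneOrbitFloor t) (hD : RobustIsohedralFloor) : IsohedralSliverGap := by
  obtain ⟨ρ, hρ, ε, hε, hfl⟩ := hD t ((eUp + t) / 2) (by linarith) hC
  refine ⟨ρ, hρ, ε, hε, ?_⟩
  intro P
  have hT' := textureForcesBadAtoms
  dsimp only at hT' ⊢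
  intro hP ha hb hd he h0 hmin hX
  haveI : IsProbabilityMeasure P := hP
  obtain ⟨R₇, R₈, R₉, hAp⟩ := hd
  have hbad : ∀ᵐ μ ∂P, ∀ q : E3, μ {q} ≠ 0 → ¬ GoodAtom (1 / 20) μ q := by
    filter_upwards [ha, hAp] with μ hμ hμA using hT' μ R₇ R₈ R₉ hμ hμA
  have hfloor : ∀ᵐ μ ∂P, (fun _ : Measure E3 => (eUp + t) / 2) μ ≤ rootEnergy lennardJones μ := by
    filter_upwards [ha, hbad, hX] with μ hμ hμb hμs using hfl μ hμ hμb hμs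
  have hint : Integrable (fun ν => rootEnergy lennardJones ν) P := integrable_rootEnergy_of_ae_hardCore (by norm_num) ha
  have h1 : ∫ _ : Measure E3, (eUp + t) / 2 ∂P ≤ ∫ μ, rootEnergy lennardJones μ ∂P := integral_mono_ae (integrable_const _) hint hfloor
  have h1' : ∫ _ : Measure E3, (eUp + t) / 2 ∂P = (eUp + t) / 2 := by simp
  have h2 : (⨅ Q : PeriodicConfiguration 3, Q.energyPerParticle lennardJones) ≤ eUp := eStar_le_of_periodicEnergyCeiling hU
  linarith

/-- ★ THE SPLIT: sliver gap ∧ diverse-law residual ⟹ no admissible minimiser at all. [new: junction] -/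
theorem noAdmissibleMinimiser_of_sliver_split (hF : IsohedralSliverGap) (hE : DiverseLawGap) : NoAdmissibleMinimiserWith fun _ => True := by
  obtain ⟨ρ, hρ, ε, hε, hFε⟩ := hF
  exact noAdmissibleMinimiserWith_split _ hFε (hE ρ hρ ε hε)

/-- ★ the crux BY NAME from the split. [new: junction] -/
theorem aperiodicFrustratedLawGap_of_sliver_split (hF : IsohedralSliverGap) (hE : DiverseLawGap) :
    Summit.AtomisticToContinuum.Crystallization.Theses.FrustratedLawDichotomy.AperiodicFrustratedLawGap :=
  aperiodicFrustratedLawGap_of_noAdmissibleMinimiser (noAdmissibleMinimiser_of_sliver_split hF hE)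

/-- ★★ THE NODE: UP(eUp) ∧ (eUp < t) ∧ C(t) ∧ D ∧ E ⟹ the crux `AperiodicFrustratedLawGap` (stmt-27623) BY NAME (T discharged by the tree).  At
landing `hU` is the tree theorem `…PeriodicEnergyCeilingKernel.periodicEnergyCeiling_holds` (`eUp = −0.7175`). [new: junction] -/
theorem aperiodicFrustratedLawGap_of_isohedralCut {eUp t : ℝ} (hU : PeriodicEnergyCeiling eUp) (ht : eUp < t)
    (hC : OneOrbitFloor t) (hD : RobustIsohedralFloor) (hE : DiverseLawGap) :
    Summit.AtomisticToContinuum.Crystallization.Theses.FrustratedLawDichotomy.AperiodicFrustratedLawGap :=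
  aperiodicFrustratedLawGap_of_sliver_split (isohedralSliverGap_of_pieces hU ht hC hD) hE

/-- ★ THE RELATIVE NODE: sliver gap ∧ E_A(η) ⟹ the residual of record A(η) = `OffAtlasMassGap n K η` BY NAME. [new: junction] -/
theorem offAtlasMassGap_of_sliver_split {n : ℕ} {K : ℕ → Set (Measure E3)} {η : ℝ} (hF : IsohedralSliverGap)
    (hEA : DiverseOffAtlasMassGap n K η) : OffAtlasMassGap n K η := by
  obtain ⟨ρ, hρ, ε, hε, hFε⟩ := hF
  refine noAdmissibleMinimiserWith_relSplit (fun P => ∀ᵐ μ ∂P, Sliver ε ρ μ) _ ?_ ?_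
  · exact noAdmissibleMinimiserWith_mono (fun _ h => h.2) hFε
  · exact noAdmissibleMinimiserWith_mono (fun _ h => ⟨h.2, h.1⟩) (hEA ρ hρ ε hε)

/-- A(η) from the pieces UP, C, D and the relative residual E_A(η) (T discharged by the tree). [new: junction] -/
theorem offAtlasMassGap_of_isohedralCut {eUp t : ℝ} {n : ℕ} {K : ℕ → Set (Measure E3)} {η : ℝ}
    (hU : PeriodicEnergyCeiling eUp) (ht : eUp < t) (hC : OneOrbitFloor t) (hD : RobustIsohedralFloor) (hEA : DiverseOffAtlasMassGap n K η) :
    OffAtlasMassGap n K η :=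
  offAtlasMassGap_of_sliver_split (isohedralSliverGap_of_pieces hU ht hC hD) hEA

/-! ## §4. Weakness certificates (each residual is implied by what it refines) -/

/-- no admissible minimiser ⟹ E. [new: bookkeeping] -/
theorem diverseLawGap_of_noAdmissibleMinimiser (h : NoAdmissibleMinimiserWith fun _ => True) : DiverseLawGap :=
  fun _ _ _ _ => noAdmissibleMinimiserWith_mono (fun _ _ => trivial) h

/-- no admissible minimiser ⟹ F (so F is crux-implied too: it is WEAKER, and PROVED from T, UP, C, D regardless). [new: bookkeeping] -/
theorem isohedralSliverGap_of_noAdmissibleMinimiser (h : NoAdmissibleMinimiserWith fun _ => True) : IsohedralSliverGap :=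
  ⟨1, one_pos, 1, one_pos, noAdmissibleMinimiserWith_mono (fun _ _ => trivial) h⟩

/-- crux ⟹ E: the residual is weaker than the crux. [new: bookkeeping] -/
theorem diverseLawGap_of_aperiodicFrustratedLawGap
    (h : Summit.AtomisticToContinuum.Crystallization.Theses.FrustratedLawDichotomy.AperiodicFrustratedLawGap) : DiverseLawGap :=
  diverseLawGap_of_noAdmissibleMinimiser (noAdmissibleMinimiser_of_aperiodicFrustratedLawGap h)

/-- crux ⟺ F ∧ E (the node's one equivalence; F carries independent, provable content). [new: bookkeeping] -/
theorem aperiodicFrustratedLawGap_iff_sliver_split :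
    Summit.AtomisticToContinuum.Crystallization.Theses.FrustratedLawDichotomy.AperiodicFrustratedLawGap ↔ IsohedralSliverGap ∧ DiverseLawGap :=
  ⟨fun h => ⟨isohedralSliverGap_of_noAdmissibleMinimiser (noAdmissibleMinimiser_of_aperiodicFrustratedLawGap h),
    diverseLawGap_of_aperiodicFrustratedLawGap h⟩, fun h => aperiodicFrustratedLawGap_of_sliver_split h.1 h.2⟩

/-- A(η) ⟹ E_A(η): the relative residual is weaker than the residual of record. [new: bookkeeping] -/
theorem diverseOffAtlasMassGap_of_offAtlasMassGap {n : ℕ} {K : ℕ → Set (Measure E3)} {η : ℝ} (h : OffAtlasMassGap n K η) :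
    DiverseOffAtlasMassGap n K η :=
  fun _ _ _ _ => noAdmissibleMinimiserWith_mono (fun _ h' => h'.2) h

/-- E ⟹ E_A(η): the relative residual is weaker than E as well. [new: bookkeeping] -/
theorem diverseOffAtlasMassGap_of_diverseLawGap {n : ℕ} {K : ℕ → Set (Measure E3)} {η : ℝ} (h : DiverseLawGap) :
    DiverseOffAtlasMassGap n K η :=
  fun ρ hρ ε hε => noAdmissibleMinimiserWith_mono (fun _ h' => h'.1) (h ρ hρ ε hε)

/-- A(η) ⟺ F ∧ E_A(η) given nothing else (F is crux-free content; kernel both ways). [new: bookkeeping] -/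
theorem offAtlasMassGap_iff_sliver_split {n : ℕ} {K : ℕ → Set (Measure E3)} {η : ℝ} (hF : IsohedralSliverGap) :
    OffAtlasMassGap n K η ↔ DiverseOffAtlasMassGap n K η :=
  ⟨diverseOffAtlasMassGap_of_offAtlasMassGap, offAtlasMassGap_of_sliver_split hF⟩

/-! ## §5. The complexity ladder `L = 1, 2, …` (finite range `L` orbits; residual = minimisers of unbounded local complexity)

For `L ≥ 2` the root energy of an `L`-orbit crystal is an orbit's site energy, not the energy per particle, so the finite range is stated at LAW
level (point-stationarity equidistributes the root over the orbits — Palm bookkeeping inside the instrument).  The residuals weaken along the ladder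
(`complexLawGap_mono`); NO finite `L` reaches the crux: `⋂_L` (co-range) = admissible minimisers of unbounded local complexity, the genuinely
aperiodic enemy (quasiperiodic / Frank–Kasper-network / glassy textures). -/

/-- **At most `L` congruence classes of `ρ`-environments at tolerance `ε`** (and covered): the value `L` of the complexity dial. -/
def SliverL (L : ℕ) (ε ρ : ℝ) (μ : Measure E3) : Prop :=
  Covered μ ∧ ∃ c : Fin L → E3, (∀ l : Fin L, μ {c l} ≠ 0) ∧ ∀ q : E3, μ {q} ≠ 0 → ∃ l : Fin L, EnvCongr ε ρ μ (c l) q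

/-- **At most `L` orbits**: the weight-preserving isometries of space have `≤ L` orbits on the atoms (covered ones = crystallographic structures with
`≤ L` Wyckoff orbits). -/
def MultiOrbit (L : ℕ) (μ : Measure E3) : Prop :=
  ∃ c : Fin L → E3, (∀ l : Fin L, μ {c l} ≠ 0) ∧
    ∀ q : E3, μ {q} ≠ 0 → ∃ l : Fin L, ∃ g : E3 ≃ᵢ E3, g (c l) = q ∧ ∀ z : E3, μ {g z} = μ {z}

/-- the `L = 1` rung contains the pairwise sliver of §1 (any atom is a representative). [new: bookkeeping] -/
theorem sliverL_one_of_sliver {ε ρ : ℝ} {μ : Measure E3} (h : Sliver ε ρ μ) {a : E3} (ha : μ {a} ≠ 0) : SliverL 1 ε ρ μ :=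
  ⟨h.1, fun _ => a, fun _ => ha, fun q hq => ⟨0, h.2 a q ha hq⟩⟩

/-- the rungs grow with `L`. [new: bookkeeping] -/
theorem sliverL_mono {L L' : ℕ} (hL : L ≤ L') (h0 : 0 < L) {ε ρ : ℝ} {μ : Measure E3} (h : SliverL L ε ρ μ) : SliverL L' ε ρ μ := by
  obtain ⟨hc, c, hca, hcq⟩ := h
  refine ⟨hc, fun l' => if h : (l' : ℕ) < L then c ⟨l', h⟩ else c ⟨0, h0⟩, fun l' => ?_, fun q hq => ?_⟩
  · show μ {if h : (l' : ℕ) < L then c ⟨l', h⟩ else c ⟨0, h0⟩} ≠ 0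
    split_ifs <;> exact hca _
  · obtain ⟨l, hl⟩ := hcq q hq
    refine ⟨Fin.castLE hL l, ?_⟩
    have hlt : ((Fin.castLE hL l : Fin L') : ℕ) < L := by simp
    show EnvCongr ε ρ μ (if h : ((Fin.castLE hL l : Fin L') : ℕ) < L then c ⟨(Fin.castLE hL l : Fin L'), h⟩ else c ⟨0, h0⟩) q
    rw [dif_pos hlt]
    have hll : (⟨((Fin.castLE hL l : Fin L') : ℕ), hlt⟩ : Fin L) = l := Fin.ext (by simp)
    rwa [hll]

/-- C_L(t) ★ «`L`-ORBIT LAW FLOOR» — FINITE RANGE `L` [WEAKER · INSTRUMENTABLE (certified `≤ L`-orbit lattice sums + Palm weights) · UNDECIDED(test)]: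
a point-stationary probability law almost surely carried by rooted `7/10`-hard-core, covered, all-`1/20`-bad configurations with `≤ L` orbits has mean
root energy `≥ t`.  Wanted with some `t > −0.7175` (for `L = 2` the family contains A15-type structures: expected margin ≈ 1 %). [new: junction] -/
def MultiOrbitLawFloor (L : ℕ) (t : ℝ) : Prop :=
  ∀ P : Measure (Measure E3), IsProbabilityMeasure P → IsPointStationaryLaw P → (∀ᵐ μ ∂P, IsRootedHardCore (7 / 10) μ) →
    (∀ᵐ μ ∂P, ∀ q : E3, μ {q} ≠ 0 → ¬ GoodAtom (1 / 20) μ q) → (∀ᵐ μ ∂P, Covered μ ∧ MultiOrbit L μ) →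
    t ≤ ∫ μ, rootEnergy lennardJones μ ∂P

/-- D_L ★ «ROBUST MULTIREGULAR FLOOR» — ASYMPTOTIC REGIME at rung `L` [WEAKER · ATTACKABLE (L)]: an `L`-orbit law floor transfers with any loss to laws
almost surely in the rung-`L` sliver, for SOME `(ρ, ε)` (tightness of hard-core rooted laws; the weak limit is carried by exactly `ρ`-`L`-regular Delone
sets, which are multiregular with `≤ L` orbits past the regularity radius — local criterion for multiregular systems, Dolbilin–Lagarias–Senechal 1998;
point-stationarity, badness and coveredness are closed; the mean root energy is weakly continuous under uniform `r⁻⁶` tails). [new: junction] -/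
def RobustMultiregularFloor (L : ℕ) : Prop :=
  ∀ t t' : ℝ, t' < t → MultiOrbitLawFloor L t → ∃ ρ : ℝ, 0 < ρ ∧ ∃ ε : ℝ, 0 < ε ∧
    ∀ P : Measure (Measure E3), IsProbabilityMeasure P → IsPointStationaryLaw P → (∀ᵐ μ ∂P, IsRootedHardCore (7 / 10) μ) →
      (∀ᵐ μ ∂P, ∀ q : E3, μ {q} ≠ 0 → ¬ GoodAtom (1 / 20) μ q) → (∀ᵐ μ ∂P, SliverL L ε ρ μ) →
      t' ≤ ∫ μ, rootEnergy lennardJones μ ∂P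

/-- F_L ★ «RUNG-`L` SLIVER GAP» [WEAKER · PROVED below from UP, C_L, D_L (T from the tree)]. [new: junction] -/
def ComplexitySliverGap (L : ℕ) : Prop :=
  ∃ ρ : ℝ, 0 < ρ ∧ ∃ ε : ℝ, 0 < ε ∧ NoAdmissibleMinimiserWith fun P => ∀ᵐ μ ∂P, SliverL L ε ρ μ

/-- E_L ★ «RUNG-`L` RESIDUAL» [DECLARED RESIDUAL at rung `L` · weakens as `L` grows · IDEA-NEEDED]: for every `(ρ, ε)`, no admissible minimising law has
local complexity `> L` with positive probability. [new: junction] -/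
def ComplexLawGap (L : ℕ) : Prop :=
  ∀ ρ : ℝ, 0 < ρ → ∀ ε : ℝ, 0 < ε → NoAdmissibleMinimiserWith fun P => ¬ ∀ᵐ μ ∂P, SliverL L ε ρ μ

/-- ★★ F_L PROVED from the rung-`L` triple. [new: junction] -/
theorem complexitySliverGap_of_pieces {L : ℕ} {eUp t : ℝ} (hU : PeriodicEnergyCeiling eUp) (ht : eUp < t)
    (hC : MultiOrbitLawFloor L t) (hD : RobustMultiregularFloor L) : ComplexitySliverGap L := by
  obtain ⟨ρ, hρ, ε, hε, hfl⟩ := hD t ((eUp + t) / 2) (by linarith) hC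
  refine ⟨ρ, hρ, ε, hε, ?_⟩
  intro P
  have hT' := textureForcesBadAtoms
  dsimp only at hT' ⊢
  intro hP ha hb hd he h0 hmin hX
  obtain ⟨R₇, R₈, R₉, hAp⟩ := hd
  have hbad : ∀ᵐ μ ∂P, ∀ q : E3, μ {q} ≠ 0 → ¬ GoodAtom (1 / 20) μ q := by
    filter_upwards [ha, hAp] with μ hμ hμA using hT' μ R₇ R₈ R₉ hμ hμA
  have h1 := hfl P hP hb ha hbad hX
  have h2 : (⨅ Q : PeriodicConfiguration 3, Q.energyPerParticle lennardJones) ≤ eUp := eStar_le_of_periodicEnergyCeiling hU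
  linarith

/-- ★ rung `L` of the ladder decides the crux BY NAME together with its residual. [new: junction] -/
theorem aperiodicFrustratedLawGap_of_complexityCut {L : ℕ} {eUp t : ℝ} (hU : PeriodicEnergyCeiling eUp)
    (ht : eUp < t) (hC : MultiOrbitLawFloor L t) (hD : RobustMultiregularFloor L) (hE : ComplexLawGap L) :
    Summit.AtomisticToContinuum.Crystallization.Theses.FrustratedLawDichotomy.AperiodicFrustratedLawGap := by
  obtain ⟨ρ, hρ, ε, hε, hF⟩ := complexitySliverGap_of_pieces hU ht hC hD
  exact aperiodicFrustratedLawGap_of_noAdmissibleMinimiser (noAdmissibleMinimiserWith_split _ hF (hE ρ hρ ε hε))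

/-- crux ⟹ E_L (every rung's residual is weaker than the crux). [new: bookkeeping] -/
theorem complexLawGap_of_aperiodicFrustratedLawGap (L : ℕ)
    (h : Summit.AtomisticToContinuum.Crystallization.Theses.FrustratedLawDichotomy.AperiodicFrustratedLawGap) : ComplexLawGap L :=
  fun _ _ _ _ => noAdmissibleMinimiserWith_mono (fun _ _ => trivial) (noAdmissibleMinimiser_of_aperiodicFrustratedLawGap h)

/-- ★ THE LADDER: `E_L ⟹ E_{L'}` for `1 ≤ L ≤ L'` — the residual weakens rung by rung (and never vanishes at finite `L`). [new: bookkeeping] -/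
theorem complexLawGap_mono {L L' : ℕ} (hL : L ≤ L') (h0 : 0 < L) (h : ComplexLawGap L) : ComplexLawGap L' :=
  fun ρ hρ ε hε => noAdmissibleMinimiserWith_mono
    (fun P (hP : ¬ ∀ᵐ μ ∂P, SliverL L' ε ρ μ) (hL1 : ∀ᵐ μ ∂P, SliverL L ε ρ μ) => hP (hL1.mono fun _ hμ => sliverL_mono hL h0 hμ))
    (h ρ hρ ε hε)

/-- E (pairwise sliver residual of §2) ⟹ E₁ (rung one): the two `L = 1` residuals agree up to the root being an atom. [new: bookkeeping] -/
theorem complexLawGap_one_of_diverseLawGap (h : DiverseLawGap) : ComplexLawGap 1 := by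
  intro ρ hρ ε hε P
  have h' := h ρ hρ ε hε P
  dsimp only at h' ⊢
  intro hP ha hb hd he h0 hmin hX
  refine h' hP ha hb hd he h0 hmin fun hS => hX ?_
  filter_upwards [hS, ha] with μ hμ hμa
  obtain ⟨S, h0S, -, rfl⟩ := hμa
  refine sliverL_one_of_sliver hμ (a := 0) ?_
  rw [Measure.restrict_apply (measurableSet_singleton 0), Set.inter_eq_self_of_subset_left (Set.singleton_subset_iff.2 h0S),
    Measure.count_singleton]
  exact one_ne_zero

end Summit.AtomisticToContinuum.Crystallization.Theorems.FrustratedLawDichotomyIsohedralCut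

end
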